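import Literature.Barriers.PneNP.TSPExtensionComplexityTours
import Mathlib.Data.Fintype.Sum
import Mathlib.Data.Fintype.Fin
import Mathlib.Algebra.BigOperators.Group.Finset.Basic
import Mathlib.Algebra.Order.BigOperators.Group.Finset
import HarnessLib

/-!
# The hub gadget: a graph whose Hamiltonian cycles encode perfect matchings

Support file for the discharge of `Literature.Barriers.PneNP.Rothvoss2017_tsp` (Rothvoß 2017,
Cor. 2: `xc(TSP(n)) ≥ 2^{Ω(n)}`). Rothvoß derives it from his Theorem 1 (the perfect matching
polytope) through "a linear projection from a face of the TSP polytope in an `O(n)`-node graph to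
the perfect matching polytope in an `n`-node graph" (§1.1, PDF p. 4, citing Yannakakis 1991).
For the formal proof we use OUR OWN linear-size gadget with that property, chosen so that every
fact about its tours follows from the local degree-two property of Hamiltonian cycles
(`…Tours.lean`):

* vertices `HV n h s`: the `n` original vertices `v i`, a private companion `w i` of each, `h`
  hubs (`2h = n`), and `s ≥ 0` padding vertices; `|HV n h s| = 2n + h + s`, so every number of
  cities `N ≥ 5n/2` is reached;
* the graph `hubGadget n h s`: all `v i – v j`; `v i – w i` for `i ≠ 0`; the chain
  `v 0 – pad 0 – pad 1 – ⋯ – pad (s-1) – w 0` (just `v 0 – w 0` when `s = 0`); and every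
  `w i – hub l`.

**Tour analysis** (this file): in a tour `T` of the complete graph using only gadget edges,
each hub has both tour edges into companions, so there are exactly `2h = n` hub–companion tour
edges; each companion `w i` has at most one non-hub neighbour, hence at least one hub edge; as
there are `n` companions, each has EXACTLY one (`card_hubs_at_eq_one`), so its other tour edge is
the home edge towards `v i` (through the chain for `i = 0`), and consequently every `v i` has
exactly one tour edge to another original vertex (`existsUnique_vv`): the `v–v` tour edges form a
perfect matching. The converse (every perfect matching arises) is the sibling file
`…HubGadgetTours.lean`. The construction is ours and is tagged [folklore]; it replaces the
reduction Rothvoß quotes from Yannakakis (1991).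
-/

namespace Literature.Barriers.PneNP

open Finset

/-- Vertices of the hub gadget: originals `v i`, companions `w i` (`i < n`), hubs `hub l`
(`l < h`), padding `pad j` (`j < s`). [folklore] -/
inductive HV (n h s : ℕ) : Type
  /-- the original vertices (those of `K_n`) -/
  | v (i : Fin n)
  /-- the private companion of `v i` -/
  | w (i : Fin n)
  /-- the hubs -/
  | hub (l : Fin h)
  /-- padding vertices subdividing the edge `v 0 – w 0` -/
  | pad (j : Fin s)
  deriving DecidableEq

namespace HV

variable {n h s : ℕ}

/-- `HV n h s` as a sum type. [folklore] -/
def equivSum : HV n h s ≃ (Fin n ⊕ Fin n) ⊕ (Fin h ⊕ Fin s) where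
  toFun
    | v i => Sum.inl (Sum.inl i)
    | w i => Sum.inl (Sum.inr i)
    | hub l => Sum.inr (Sum.inl l)
    | pad j => Sum.inr (Sum.inr j)
  invFun
    | Sum.inl (Sum.inl i) => v i
    | Sum.inl (Sum.inr i) => w i
    | Sum.inr (Sum.inl l) => hub l
    | Sum.inr (Sum.inr j) => pad j
  left_inv x := by cases x <;> rfl
  right_inv y := by rcases y with (i | i) | (l | j) <;> rfl

/-- `HV n h s` is finite. [folklore] -/
instance : Fintype (HV n h s) := Fintype.ofEquiv _ equivSum.symm

/-- `|HV n h s| = 2n + h + s`. [folklore] -/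
theorem card (n h s : ℕ) : Fintype.card (HV n h s) = 2 * n + h + s := by
  rw [Fintype.card_congr (equivSum (n := n) (h := h) (s := s))]
  simp only [Fintype.card_sum, Fintype.card_fin]
  ring

/-- Position on the chain `v 0 – pad 0 – ⋯ – pad (s-1) – w 0` (`0`, `1…s`, `s+1`); `none` off
the chain. [folklore] -/
def cpos : HV n h s → Option ℕ
  | v i => if (i : ℕ) = 0 then some 0 else none
  | pad j => some ((j : ℕ) + 1)
  | w i => if (i : ℕ) = 0 then some (s + 1) else none
  | hub _ => none

/-- `succOpt a b`: both positions are defined and `b = a + 1`. [folklore] -/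
def succOpt : Option ℕ → Option ℕ → Prop
  | some p, some q => q = p + 1
  | _, _ => False

/-- [folklore] -/
@[simp] theorem succOpt_none_left (b : Option ℕ) : succOpt none b = False := by
  cases b <;> rfl
/-- [folklore] -/
@[simp] theorem succOpt_none_right (a : Option ℕ) : succOpt a none = False := by
  cases a <;> rfl
/-- [folklore] -/
@[simp] theorem succOpt_some_some (p q : ℕ) : succOpt (some p) (some q) = (q = p + 1) := rfl

/-- `succOpt` is decidable. [folklore] -/
instance (a b : Option ℕ) : Decidable (succOpt a b) := by
  cases a <;> cases b <;> simp only [succOpt_none_left, succOpt_none_right, succOpt_some_some]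
    <;> infer_instance

/-- The non-chain part of the edge relation (one orientation): `v i – v j`, `v i – w i`
(`i ≠ 0`), `w i – hub l`. [folklore] -/
def baseRel : HV n h s → HV n h s → Prop
  | v i, v j => i ≠ j
  | v i, w j => i = j ∧ (i : ℕ) ≠ 0
  | w _, hub _ => True
  | _, _ => False

/-- `baseRel` is decidable. [folklore] -/
instance (x y : HV n h s) : Decidable (baseRel x y) := by
  cases x <;> cases y <;> simp only [baseRel] <;> infer_instance

/-- The generating relation of the gadget: base edges or a chain step. [folklore] -/
def rel (x y : HV n h s) : Prop := baseRel x y ∨ succOpt (cpos x) (cpos y)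

/-- `rel` is decidable. [folklore] -/
instance (x y : HV n h s) : Decidable (rel x y) := by
  unfold rel; infer_instance

end HV

open HV

/-- **The hub gadget graph** on `HV n h s`: `SimpleGraph.fromRel HV.rel`. [folklore] -/
def hubGadget (n h s : ℕ) : SimpleGraph (HV n h s) := SimpleGraph.fromRel HV.rel

/-- Adjacency is decidable. [folklore] -/
instance (n h s : ℕ) : DecidableRel (hubGadget n h s).Adj := by
  unfold hubGadget; infer_instance

variable {n h s : ℕ}

/-- Adjacency of the gadget, unfolded. [folklore] -/
theorem hubGadget_adj {x y : HV n h s} :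
    (hubGadget n h s).Adj x y ↔ x ≠ y ∧ (rel x y ∨ rel y x) := by
  rw [hubGadget, SimpleGraph.fromRel_adj]

/-! ### Neighbourhoods -/

/-- A hub's neighbours are companions. [folklore] -/
theorem adj_hub {l : Fin h} {y : HV n h s} (hy : (hubGadget n h s).Adj (hub l) y) :
    ∃ i, y = w i := by
  rw [hubGadget_adj] at hy
  obtain ⟨-, hr⟩ := hy
  rcases y with i | i | l' | j <;> simp [rel, baseRel, cpos] at hr
  exact ⟨i, rfl⟩

/-- Hubs and companions are adjacent. [folklore] -/
theorem adj_hub_w (l : Fin h) (i : Fin n) : (hubGadget n h s).Adj (hub l) (w i) := by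
  rw [hubGadget_adj]
  exact ⟨by simp, Or.inr (Or.inl trivial)⟩

/-- Distinct originals are adjacent. [folklore] -/
theorem adj_v_v {i j : Fin n} (hij : i ≠ j) : (hubGadget n h s).Adj (v i) (v j) := by
  rw [hubGadget_adj]
  exact ⟨by simpa using hij, Or.inl (Or.inl hij)⟩

/-- `v i – w i` for `i ≠ 0`. [folklore] -/
theorem adj_v_w {i : Fin n} (hi : (i : ℕ) ≠ 0) : (hubGadget n h s).Adj (v i) (w i) := by
  rw [hubGadget_adj]
  exact ⟨by simp, Or.inl (Or.inl ⟨rfl, hi⟩)⟩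

/-- Consecutive chain positions are adjacent. [folklore] -/
theorem adj_of_cpos {x y : HV n h s} (hne : x ≠ y) {p : ℕ} (hx : cpos x = some p)
    (hy : cpos y = some (p + 1)) : (hubGadget n h s).Adj x y := by
  rw [hubGadget_adj]
  refine ⟨hne, Or.inl (Or.inr ?_)⟩
  rw [hx, hy, succOpt_some_some]

variable (hn : 0 < n)

/-- The home neighbour of the companion `w i`: `v i`, except that `w 0` hangs at the top of the
chain (`pad (s-1)`, or `v 0` if `s = 0`). [folklore] -/
def wHome (s : ℕ) (i : Fin n) : HV n h s :=
  if (i : ℕ) = 0 then (if hs : s = 0 then v i else pad ⟨s - 1, by omega⟩) else v i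

/-- The home neighbour of the original `v i`: `w i`, except that `v 0` starts the chain
(`pad 0`, or `w 0` if `s = 0`). [folklore] -/
def vHome (s : ℕ) (i : Fin n) : HV n h s :=
  if (i : ℕ) = 0 then (if hs : s = 0 then w i else pad ⟨0, by omega⟩) else w i

include hn in
/-- Chain predecessor of `pad j`. [folklore] -/
def padPrev (j : Fin s) : HV n h s :=
  if hj : (j : ℕ) = 0 then v ⟨0, hn⟩ else pad ⟨(j : ℕ) - 1, by omega⟩

include hn in
/-- Chain successor of `pad j`. [folklore] -/
def padNext (j : Fin s) : HV n h s :=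
  if hj : (j : ℕ) + 1 = s then w ⟨0, hn⟩ else pad ⟨(j : ℕ) + 1, by omega⟩

/-- A companion's neighbours: hubs, or its home neighbour. [folklore] -/
theorem adj_w {i : Fin n} {y : HV n h s} (hy : (hubGadget n h s).Adj (w i) y) :
    (∃ l, y = hub l) ∨ y = wHome s i := by
  rw [hubGadget_adj] at hy
  obtain ⟨hne, hr⟩ := hy
  rcases y with j | j | l | j
  · -- an original: only `v i` with `i ≠ 0`, or `v 0` at the bottom of an empty chain
    right
    simp only [rel, baseRel, cpos, false_or] at hr
    unfold wHome
    rcases hr with hr | ⟨rfl, hi⟩ | hr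
    · split_ifs at hr <;> simp at hr
    · simp [hi]
    · split_ifs at hr with h1 h2 h2
      · simp only [succOpt_some_some] at hr
        have hs : s = 0 := by omega
        subst hs
        have hij : j = i := Fin.ext (by omega)
        subst hij
        simp [h1]
      · simp at hr
      · simp at hr
      · simp at hr
  · -- another companion: never
    exfalso
    simp only [rel, baseRel, cpos, false_or] at hr
    rcases hr with hr | hr <;> split_ifs at hr <;> simp at hr
  · exact Or.inl ⟨l, rfl⟩
  · -- a pad: only the top of the chain, at `w 0`
    right
    simp only [rel, baseRel, cpos, false_or] at hr
    unfold wHome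
    rcases hr with hr | hr
    · split_ifs at hr with h1
      · simp only [succOpt_some_some] at hr
        omega
      · simp at hr
    · split_ifs at hr with h1
      · simp only [succOpt_some_some] at hr
        have hs : s ≠ 0 := by omega
        simp only [h1, ↓reduceIte, hs, ↓reduceDIte, HV.pad.injEq]
        exact Fin.ext (by simp only; omega)
      · simp at hr

/-- A pad's neighbours: its chain predecessor and successor. [folklore] -/
theorem adj_pad {j : Fin s} {y : HV n h s} (hy : (hubGadget n h s).Adj (pad j) y) :
    y = padPrev hn j ∨ y = padNext hn j := by
  rw [hubGadget_adj] at hy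
  obtain ⟨hne, hr⟩ := hy
  simp only [rel, baseRel, false_or] at hr
  rcases y with i | i | l | j'
  · -- `v 0` below `pad 0`
    simp only [cpos] at hr
    rcases hr with hr | hr <;> split_ifs at hr with h1 <;>
      simp only [succOpt_some_some, succOpt_none_right, succOpt_none_left] at hr
    · omega
    · left
      unfold padPrev
      have hj : (j : ℕ) = 0 := by omega
      simp only [hj, ↓reduceDIte, HV.v.injEq]
      exact Fin.ext h1
  · -- `w 0` above `pad (s-1)`
    simp only [cpos] at hr
    rcases hr with hr | hr <;> split_ifs at hr with h1 <;>
      simp only [succOpt_some_some, succOpt_none_right, succOpt_none_left] at hr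
    · right
      unfold padNext
      have hj : (j : ℕ) + 1 = s := by omega
      simp only [hj, ↓reduceDIte, HV.w.injEq]
      exact Fin.ext h1
    · omega
  · simp [cpos] at hr
  · simp only [cpos, succOpt_some_some] at hr
    rcases hr with hr | hr
    · right
      unfold padNext
      have hj : (j : ℕ) + 1 ≠ s := by omega
      simp only [hj, ↓reduceDIte, HV.pad.injEq]
      exact Fin.ext (by simp only; omega)
    · left
      unfold padPrev
      have hj : (j : ℕ) ≠ 0 := by omega
      simp only [hj, ↓reduceDIte, HV.pad.injEq]
      exact Fin.ext (by simp only; omega)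

/-- An original's neighbours: other originals, or its home neighbour. [folklore] -/
theorem adj_v {i : Fin n} {y : HV n h s} (hy : (hubGadget n h s).Adj (v i) y) :
    (∃ j, y = v j) ∨ y = vHome s i := by
  rw [hubGadget_adj] at hy
  obtain ⟨hne, hr⟩ := hy
  rcases y with j | j | l | j
  · exact Or.inl ⟨j, rfl⟩
  · right
    simp only [rel, baseRel, cpos, false_or] at hr
    unfold vHome
    rcases hr with (⟨rfl, hi⟩ | hr) | hr
    · simp [hi]
    · split_ifs at hr with h1 h2 h2 <;>
        simp only [succOpt_some_some, succOpt_none_right, succOpt_none_left] at hr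
      have hs : s = 0 := by omega
      subst hs
      have hij : j = i := Fin.ext (by omega)
      subst hij
      simp [h1]
    · split_ifs at hr with h1 h2 h2 <;>
        simp only [succOpt_some_some, succOpt_none_right, succOpt_none_left] at hr
      omega
  · exfalso
    simp [rel, baseRel, cpos] at hr
  · right
    simp only [rel, baseRel, cpos, false_or] at hr
    unfold vHome
    rcases hr with hr | hr <;> split_ifs at hr with h1 <;>
      simp only [succOpt_some_some, succOpt_none_right, succOpt_none_left] at hr
    · have hs : s ≠ 0 := by omega
      simp only [h1, ↓reduceIte, hs, ↓reduceDIte, HV.pad.injEq]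
      exact Fin.ext (by simp only; omega)
    · omega

/-- The home neighbour of an original is never an original. [folklore] -/
theorem vHome_ne_v (i j : Fin n) : (vHome s i : HV n h s) ≠ v j := by
  unfold vHome
  split_ifs <;> simp

/-! ### Tours of the gadget -/

section tour

variable {T : Finset (Sym2 (HV n h s))} (hT : IsTourOn T)
  (hTG : ∀ e ∈ T, e ∈ (hubGadget n h s).edgeSet)
include hT hTG

/-- Every companion has a tour edge to some hub. [folklore] -/
theorem exists_hub_edge (i : Fin n) : ∃ l, s(w i, hub l) ∈ T := by
  by_contra hno
  push Not at hno
  have hsub : (T.filter fun e => w i ∈ e) ⊆ {s(w i, wHome s i)} := by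
    intro e he
    rw [mem_filter] at he
    obtain ⟨y, hy, rfl⟩ := edge_eq_of_supported hTG he.1 he.2
    rw [mem_singleton]
    rcases adj_w hy with ⟨l, rfl⟩ | rfl
    · exact absurd he.1 (hno l)
    · rfl
  have := card_le_card hsub
  rw [hT.card_filter_mem, card_singleton] at this
  omega

/-- Each hub has exactly two companions attached by tour edges. [folklore] -/
theorem card_w_at_hub (l : Fin h) : (univ.filter fun i : Fin n => s(w i, hub l) ∈ T).card = 2 := by
  have himg : (univ.filter fun i : Fin n => s(w i, hub l) ∈ T).image
      (fun i => s(w i, (hub l : HV n h s))) = T.filter fun e => hub l ∈ e := by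
    ext e
    simp only [mem_image, mem_filter, mem_univ, true_and]
    constructor
    · rintro ⟨i, hi, rfl⟩
      exact ⟨hi, Sym2.mem_mk_right _ _⟩
    · rintro ⟨he, hle⟩
      obtain ⟨y, hy, rfl⟩ := edge_eq_of_supported hTG he hle
      obtain ⟨i, rfl⟩ := adj_hub hy
      exact ⟨i, by rwa [Sym2.eq_swap], Sym2.eq_swap⟩
  have hinj : Function.Injective fun i : Fin n => s(w i, (hub l : HV n h s)) := by
    intro i j hij
    simp only [Sym2.eq_iff, HV.w.injEq, reduceCtorEq, and_false, or_false] at hij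
    exact hij.1
  rw [← card_image_of_injective _ hinj, himg, hT.card_filter_mem]

/-- **Each companion has exactly one hub tour edge** (`2h = n` hub–companion edges shared by
`n` companions, each having at least one). [folklore] -/
theorem card_hubs_at_eq_one (hhn : 2 * h = n) (i : Fin n) :
    (univ.filter fun l : Fin h => s(w i, hub l) ∈ T).card = 1 := by
  classical
  set f : Fin n → ℕ := fun i => (univ.filter fun l : Fin h => s(w i, hub l) ∈ T).card with hf
  have hge : ∀ i, 1 ≤ f i := fun i => by
    obtain ⟨l, hl⟩ := exists_hub_edge hT hTG i
    exact card_pos.2 ⟨l, mem_filter.2 ⟨mem_univ _, hl⟩⟩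
  have hsum : ∑ i, f i = n := by
    simp only [hf, card_filter]
    rw [sum_comm]
    have : ∀ l : Fin h, (∑ i : Fin n, if s(w i, (hub l : HV n h s)) ∈ T then 1 else 0) = 2 := by
      intro l
      rw [← card_filter]
      exact card_w_at_hub hT hTG l
    simp only [this, sum_const, card_univ, Fintype.card_fin, smul_eq_mul]
    omega
  by_contra hne
  have hgt : 1 < f i := lt_of_le_of_ne (hge i) (Ne.symm hne)
  have hlt : ∑ _i : Fin n, (1 : ℕ) < ∑ i, f i :=
    sum_lt_sum (fun j _ => hge j) ⟨i, mem_univ _, hgt⟩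
  rw [hsum] at hlt
  simp at hlt

/-- Each companion uses its home edge. [folklore] -/
theorem wHome_mem (hhn : 2 * h = n) (i : Fin n) : s(w i, wHome s i) ∈ T := by
  by_contra hno
  -- then both tour edges at `w i` go to hubs
  obtain ⟨e₁, e₂, hne, h12⟩ := card_eq_two.1 (hT.card_filter_mem (w i))
  have h1 : e₁ ∈ T.filter fun e => w i ∈ e := by rw [h12]; simp
  have h2 : e₂ ∈ T.filter fun e => w i ∈ e := by rw [h12]; simp
  rw [mem_filter] at h1 h2
  obtain ⟨y₁, hy₁, rfl⟩ := edge_eq_of_supported hTG h1.1 h1.2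
  obtain ⟨y₂, hy₂, rfl⟩ := edge_eq_of_supported hTG h2.1 h2.2
  rcases adj_w hy₁ with ⟨l₁, rfl⟩ | rfl
  · rcases adj_w hy₂ with ⟨l₂, rfl⟩ | rfl
    · have hl : l₁ ≠ l₂ := fun h => hne (by rw [h])
      have hsub : ({l₁, l₂} : Finset (Fin h)) ⊆ univ.filter fun l : Fin h => s(w i, hub l) ∈ T := by
        intro l hl'
        simp only [mem_insert, mem_singleton] at hl'
        rw [mem_filter]
        rcases hl' with rfl | rfl
        · exact ⟨mem_univ _, h1.1⟩
        · exact ⟨mem_univ _, h2.1⟩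
      have := card_le_card hsub
      rw [card_pair hl, card_hubs_at_eq_one hT hTG hhn] at this
      omega
    · exact hno h2.1
  · exact hno h1.1

include hn in
/-- Each original uses its home edge. [folklore] -/
theorem vHome_mem (hhn : 2 * h = n) (i : Fin n) : s(v i, vHome s i) ∈ T := by
  by_cases hi : (i : ℕ) = 0
  · by_cases hs : s = 0
    · -- empty chain: the home edge of `w 0` is `w 0 – v 0`
      have h1 := wHome_mem hT hTG hhn i
      unfold wHome at h1
      unfold vHome
      simp only [hi, ↓reduceIte, hs, ↓reduceDIte] at h1 ⊢
      rwa [Sym2.eq_swap]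
    · -- `pad 0` has exactly the neighbours `v 0` and its successor
      have hs' : 0 < s := Nat.pos_of_ne_zero hs
      have hboth := hT.both_mem hTG (v := pad ⟨0, hs'⟩) (a := padPrev hn ⟨0, hs'⟩)
        (b := padNext hn ⟨0, hs'⟩) fun y hy => adj_pad hn hy
      have h1 := hboth.1
      unfold padPrev at h1
      simp only [↓reduceDIte] at h1
      unfold vHome
      simp only [hi, ↓reduceIte, hs, ↓reduceDIte]
      have hi' : (⟨0, hn⟩ : Fin n) = i := Fin.ext (by simp [hi])
      rw [← hi', Sym2.eq_swap]
      exact h1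
  · have h1 := wHome_mem hT hTG hhn i
    unfold wHome at h1
    unfold vHome
    simp only [hi, ↓reduceIte] at h1 ⊢
    rwa [Sym2.eq_swap]

include hn in
/-- **Every original has exactly one tour edge to another original.** [folklore] -/
theorem existsUnique_vv (hhn : 2 * h = n) (i : Fin n) : ∃! j, s(v i, v j) ∈ T := by
  have hhome := vHome_mem hn hT hTG hhn i
  obtain ⟨e₁, e₂, hne, h12⟩ := card_eq_two.1 (hT.card_filter_mem (v i))
  have h1 : e₁ ∈ T.filter fun e => v i ∈ e := by rw [h12]; simp
  have h2 : e₂ ∈ T.filter fun e => v i ∈ e := by rw [h12]; simp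
  rw [mem_filter] at h1 h2
  -- existence: not both tour edges at `v i` are the home edge
  have hex : ∃ j, s(v i, v j) ∈ T := by
    obtain ⟨y₁, hy₁, rfl⟩ := edge_eq_of_supported hTG h1.1 h1.2
    obtain ⟨y₂, hy₂, rfl⟩ := edge_eq_of_supported hTG h2.1 h2.2
    rcases adj_v hy₁ with ⟨j, rfl⟩ | rfl
    · exact ⟨j, h1.1⟩
    rcases adj_v hy₂ with ⟨j, rfl⟩ | rfl
    · exact ⟨j, h2.1⟩
    exact absurd rfl hne
  obtain ⟨j, hj⟩ := hex
  refine ⟨j, hj, fun j' hj' => ?_⟩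
  -- uniqueness: a second original neighbour would be a third tour edge at `v i`
  by_contra hjj
  have hne1 : (s(v i, v j) : Sym2 (HV n h s)) ≠ s(v i, vHome s i) := fun h' => by
    have := Sym2.congr_right.1 h'
    exact vHome_ne_v (h := h) i j this.symm
  rcases hT.eq_or_eq_of_mem hj hhome hne1 (Sym2.mem_mk_left _ _) (Sym2.mem_mk_left _ _) hj'
    (Sym2.mem_mk_left _ _) with h' | h'
  · have hv : (v j' : HV n h s) = v j := Sym2.congr_right.1 h'
    simp only [HV.v.injEq] at hv
    exact hjj hv
  · exact vHome_ne_v i j' (Sym2.congr_right.1 h').symm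

omit hTG in
/-- The `v–v` relation of a tour is symmetric and loop-free: the partner of the partner is the
vertex itself, and no vertex is its own partner. [folklore] -/
theorem vv_symm {i j : Fin n} (hij : s(v i, v j) ∈ T) : s(v j, v i) ∈ T ∧ i ≠ j := by
  refine ⟨by rwa [Sym2.eq_swap], fun h' => ?_⟩
  subst h'
  exact hT.not_isDiag hij (by simp)

end tour

end Literature.Barriers.PneNP
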